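import Summits.RiemannHypothesis.RiemannHypothesis.Theses.SpectralTrace
import Summits.RiemannHypothesis.RiemannHypothesis.Theorems.WindowTraceArch.Negative.UnitMass
import Summits.RiemannHypothesis.RiemannHypothesis.Theorems.WindowTraceArch.Negative.LocalWeyl
import Summits.RiemannHypothesis.RiemannHypothesis.Theorems.WindowTraceArch.Negative.ComplexSpectrum
import Summits.RiemannHypothesis.RiemannHypothesis.Theorems.WindowTraceArch.Negative.FiniteSpectrum
import Literature.NumberTheory.LFunctions.WeilCriterionProofs
import HarnessLib

/-!
# Disproof work file for the crux `SpectralIsHpSpectrum` (stmt-RiemannHypothesis-0195)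

Standing adversary file (refuter, cdisprove seat `refuter-cdisprove-stmt-RiemannHypothesis-0195-0`).
Prose lives only in docstrings. Everything below is kernel-checked unless marked `sorry`
(near-misses, §5 only).

The crux (route `SpectralTrace`, rank 5, auto-crux):
`∀ ι (γ : ι → ℝ), IsTrace γ → ∀ z, (fibre γ z).encard = mult z`, where
`IsTrace γ := ∀ Weil g, HasSum (i ↦ ĝ(1/2 + iγ_i)) (W g)` (the route target `X` for THIS family),
`fibre γ z := {i | 1/2 + iγ_i = z}` and
`mult z := 𝟙_{non-trivial zeros}(z) · analyticOrderNatAt ζ z` (read in `ℕ∞`).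

## Findings (indexed; details in the docstrings)

* §1 WHY NO UNCONDITIONAL KILL EXISTS — `riemannHypothesis_of_isTrace` : any family satisfying the
  hypothesis proves RH (Bochner form of the trace on `g ⋆ g̃` via the landed
  `WindowTraceArch.Negative.UnitMass`, then `weil_criterion_holds`); hence
  `spectralIsHpSpectrum_of_not_riemannHypothesis : ¬ RH → crux` (vacuity branch) and
  `riemannHypothesis_of_not_spectralIsHpSpectrum : ¬ crux → RH` — A REFUTATION OF THIS CRUX IS A
  PROOF OF RH. Under RH the crux is the classical rigidity (Fourier uniqueness for locally finite
  tempered positive measures), so the crux is TRUE by excluded middle; cheap falsity search is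
  meaningless. `spectralIsHpSpectrum_iff_under_rh : crux ↔ (RH → crux)`.
* §2 WHAT IS LEFT FOR THE PROVER (reduction, all junk removed) —
  `spectralIsHpSpectrum_iff_ordinate_count :
     crux ↔ ∀ ι γ, IsTrace γ → ∀ τ : ℝ, (#{i | γ_i = τ} : ℤ) = m(1/2 + iτ)`
  (`m = riemannZetaZeroOrder`, the multiplicity used by `explicit_formula_holds`), and
  `spectralIsHpSpectrum_iff_rigidity_under_rh` (same with `RH` as a free extra hypothesis).
  Ingredients, all proved here: every fibre is FINITE (`finite_fibre`, from the landed local Weyl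
  law `finite_abs_le_of_windowTrace` — so `encard = ⊤` never happens); off the critical line both
  sides are `0` (`encard_fibre_eq_mult_of_re_ne_half`: the fibre is empty, and `z ∈` non-trivial
  zeros forces `Re z = 1/2` by the RH that the hypothesis itself supplies); on the line
  `mult (1/2+iτ) = analyticOrderAt ζ (1/2+iτ)` with NO case split on `ζ(1/2+iτ) = 0`
  (`mult_eq_analyticOrderAt_of_mem_strip`; the real point `τ = 0` needs nothing special since
  `m(1/2) = 0` by `riemannZeta_ne_zero_of_im_eq_zero_of_pos_of_lt_one` is not even used — both
  sides are the analytic order), and `m(s) = analyticOrderNatAt ζ s` for all `s ≠ 1`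
  (`riemannZetaZeroOrder_eq_analyticOrderNatAt`). The remaining content is exactly:
  two locally finite positive measures `Σ_i δ_{γ_i}` and `Σ_ρ m(ρ) δ_{Im ρ}` on `ℝ` with the same
  pairing against `{ĝ|_{1/2+iℝ} : g ∈ C_c^∞}` coincide (tempered growth of the first:
  `card_near_le_log_of_windowTrace`, landed; of the second: `weilZeroSummable`).
  BLUEPRINT WITHOUT TEMPERED DISTRIBUTIONS (Mathlib-feasible, found while looking for a gap to
  exploit — there is none): fix a Weil test `h`; for a trace family `γ` the measure
  `ν_γ := Σ_i |ĥ(1/2+iγ_i)|² δ_{γ_i}` (`Measure.sum` of weighted `dirac`s) is FINITE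
  (`hasSum_norm_sq_of_isTrace`: total mass `Re Q(h)`); for every Weil `g`,
  `∫ ĝ(1/2+i·) dν_γ = Σ_i (g ⋆ h ⋆ h̃)^(1/2+iγ_i) = W(g ⋆ h ⋆ h̃)` (`weilMellin_weilConv_holds`,
  `weilMellin_weilConv_weilReflect_half`) is the SAME number for the zeta family under RH
  (`isTrace_ordinates_of_rh`); Fubini turns `∫ ĝ dν` into `∫ g(t) · charFun ν (t) dt`, so
  `charFun ν_γ = charFun ν_Z` a.e. (`ae_eq_zero_of_integral_contDiff_smul_eq_zero`), hence
  everywhere (continuity of `charFun`), hence `ν_γ = ν_Z` (`Measure.ext_of_charFun`, finite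
  measures); evaluating at `{τ}` gives `#{i | γ_i = τ} · |ĥ(1/2+iτ)|² = m(1/2+iτ) · |ĥ(1/2+iτ)|²`, and
  a modulated narrow bump `h` has `ĥ(1/2+iτ) ≠ 0` (`exists_bump_lower`, `weilMellin_modulate`,
  landed in `LocalWeylTools`). No Schwartz-space density and no tempered distributions needed.
* §3 LOAD-BEARING HYPOTHESES (negative lemmas, witnesses explicit):
  - `spectralIsHpSpectrum_false_without_value` : weakening `HasSum … (W g)` to mere `Summable`
    makes it FALSE (witness: the EMPTY family; needs one non-trivial zero, which we get from the
    Weil machinery alone: `nontrivialZeros_nonempty` = `exists_complex_spectrum` +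
    `not_windowTrace_finite`). Any proof must use the VALUE `W g`, i.e. the explicit formula.
  - `spectralIsHpSpectrum_false_on_window_of_nonpos` : restricting the tests to a window
    `tsupport g ⊆ [-A, A]` with `A ≤ 0` makes it FALSE (junk family `ℕ ↦ 0`, fibre `= univ`,
    `encard = ⊤ ≠ mult`). For `A > 0` see §5 (expected false, open here).
  - REALNESS of `γ` is the only thing separating the hypothesis from a THEOREM:
    `exists_complex_spectrum` (landed, `ComplexSpectrum.lean`) — the zeros themselves are an
    unconditional complex spectrum. Rigidity for complex spectra is NOT claimed (Leont'ev-type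
    expansions of zero `Σ e^{λ_n t}/L'(λ_n) = 0` exist for exponential systems, though not with
    unit coefficients); a prover should not try to generalise in that direction.
  - INTEGRALITY (unit masses) is NOT load-bearing for this item: the natural proof shows equality
    of MEASURES and works verbatim for positive real weights; the prover should prove the weighted
    measure statement and specialise.
* §4 NATURAL VARIANTS DECIDED:
  - `spectralIsHpSpectrumAllZeros_iff_not_rh` : replacing "non-trivial zeros" by ALL zeros in the
    right-hand side gives a statement EQUIVALENT TO `¬ RH` (under RH the ordinate family is a
    trace, and the trivial zero `-2` has empty fibre but multiplicity `≥ 1`). So the word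
    "non-trivial" is load-bearing exactly to the extent that RH holds.
  - `onWindow_imp` : every window version implies the crux (monotonicity), so §3's window
    refutation at `A ≤ 0` does not touch the crux.
* §5 NEAR-MISSES / OPEN (docstrings only, no statement of unknown truth value is asserted):
  window rigidity for `A > 0` (toy counterexample `(π/L)ℤ` vs `2 × (2π/L)ℤ` for the functional
  `2L·δ₀` on windows `A < L`, by Poisson summation — not yet formalised in the `weilMellin`
  normalisation).
* `-- Targets`: none registered (payload `targets = []`, `stuck_stubs = []`).

USES from the sibling disprover of `WindowTraceArch` (landed, imported):
`hasSum_norm_sq_of_windowTrace` (UnitMass), `finite_abs_le_of_windowTrace` (LocalWeyl),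
`hasSum_weilMellin_zeros`, `exists_complex_spectrum`, `eq_half_add_of_riemannHypothesis`
(ComplexSpectrum), `not_windowTrace_finite`, `weilFunctional_zero` (FiniteSpectrum).
-/

noncomputable section

open Complex Set MeasureTheory Filter

namespace Summit.RiemannHypothesis.RiemannHypothesis.Cruxes.SpectralIsHpSpectrum.Disproof

open Literature.NumberTheory.LFunctions
open Summit.RiemannHypothesis.RiemannHypothesis.Theses.SpectralTrace (SpectralIsHpSpectrum)
open Summit.RiemannHypothesis.RiemannHypothesis.Theorems.WindowTraceArch.Negative

/-! ## §0 Vocabulary (definitional abbreviations of the crux's pieces) -/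

/-- The hypothesis of the crux on a real family `γ`: it reproduces `W` on every Weil test
(this is the route target `X` instantiated at `γ`). [folklore] -/
def IsTrace {ι : Type*} (γ : ι → ℝ) : Prop :=
  ∀ g : ℝ → ℂ, IsWeilTest g →
    HasSum (fun i => weilMellin g (1 / 2 + (γ i : ℂ) * I)) (weilFunctional g)

/-- The right-hand side of the crux: multiplicity of `z` as a NON-TRIVIAL zero, in `ℕ∞`. [folklore] -/
def mult (z : ℂ) : ℕ∞ :=
  ZetaZeros.riemannZetaNontrivialZeros.indicator (fun w => (analyticOrderNatAt riemannZeta w : ℕ∞)) z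

/-- The fibre of the family over `z`. [folklore] -/
def fibre {ι : Type*} (γ : ι → ℝ) (z : ℂ) : Set ι :=
  {i : ι | (1 / 2 : ℂ) + (γ i : ℂ) * I = z}

/-- The crux, unfolded into the vocabulary above (definitional). [folklore] -/
theorem spectralIsHpSpectrum_iff :
    SpectralIsHpSpectrum ↔
      ∀ (ι : Type) (γ : ι → ℝ), IsTrace γ → ∀ z : ℂ, (fibre γ z).encard = mult z :=
  Iff.rfl

/-! ## §1 Why no unconditional kill exists: the hypothesis proves RH -/

/-- A full trace is a window trace on every window. [folklore] -/
theorem windowTrace_of_isTrace {ι : Type*} {γ : ι → ℝ} (h : IsTrace γ) (A : ℝ) :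
    ∀ g : ℝ → ℂ, IsWeilTest g → tsupport g ⊆ Icc (-A) A →
      HasSum (fun i => weilMellin g (1 / 2 + (γ i : ℂ) * I)) (weilFunctional g) :=
  fun g hg _ => h g hg

/-- A compactly supported function is supported in some `[-R, R]`, `R > 0`. [folklore] -/
theorem exists_tsupport_subset_Icc {g : ℝ → ℂ} (hg : HasCompactSupport g) :
    ∃ R : ℝ, 0 < R ∧ tsupport g ⊆ Icc (-R) R := by
  obtain ⟨R, hR⟩ := hg.isCompact.isBounded.subset_closedBall 0
  refine ⟨max R 1, by positivity, hR.trans fun x hx => ?_⟩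
  rw [Metric.mem_closedBall, dist_zero_right, Real.norm_eq_abs] at hx
  have h1 := le_max_left R 1
  exact ⟨by linarith [neg_abs_le x], by linarith [le_abs_self x]⟩

/-- **Bochner form of a full trace**: `HasSum (i ↦ |ĝ(1/2+iγ_i)|²) (Re Q(g))` for every Weil test
(`hasSum_norm_sq_of_windowTrace` on a window containing `supp (g ⋆ g̃)`). [folklore] -/
theorem hasSum_norm_sq_of_isTrace {ι : Type*} {γ : ι → ℝ} (h : IsTrace γ) {g : ℝ → ℂ}
    (hg : IsWeilTest g) :
    HasSum (fun i => ‖weilMellin g (1 / 2 + (γ i : ℂ) * I)‖ ^ 2) (weilQuadratic g).re := by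
  obtain ⟨R, -, hR⟩ := exists_tsupport_subset_Icc hg.2
  refine hasSum_norm_sq_of_windowTrace (A := 2 * R) (windowTrace_of_isTrace h (2 * R)) hg ?_
  rwa [show (2 * R) / 2 = R by ring]

/-- A full trace gives Weil positivity. [folklore] -/
theorem weilPositivity_of_isTrace {ι : Type*} {γ : ι → ℝ} (h : IsTrace γ) : WeilPositivity :=
  fun _ hg => (hasSum_norm_sq_of_isTrace h hg).nonneg fun _ => by positivity

/-- **Any family satisfying the hypothesis of the crux proves RH** (Weil's criterion,
`weil_criterion_holds`). [folklore] -/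
theorem riemannHypothesis_of_isTrace {ι : Type*} {γ : ι → ℝ} (h : IsTrace γ) :
    _root_.RiemannHypothesis :=
  (show _root_.RiemannHypothesis ↔ WeilPositivity from weil_criterion_holds).2
    (weilPositivity_of_isTrace h)

/-- **Vacuity branch**: if RH fails the crux holds (no family satisfies its hypothesis). [folklore] -/
theorem spectralIsHpSpectrum_of_not_riemannHypothesis (hRH : ¬ _root_.RiemannHypothesis) :
    SpectralIsHpSpectrum :=
  fun _ _ hγ => absurd (riemannHypothesis_of_isTrace hγ) hRH

/-- **Barrier: a refutation of the crux is a proof of RH.** [folklore] -/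
theorem riemannHypothesis_of_not_spectralIsHpSpectrum (h : ¬ SpectralIsHpSpectrum) :
    _root_.RiemannHypothesis := by
  by_contra hRH
  exact h (spectralIsHpSpectrum_of_not_riemannHypothesis hRH)

/-- The crux is equivalent to its restriction to the RH world. [folklore] -/
theorem spectralIsHpSpectrum_iff_under_rh :
    SpectralIsHpSpectrum ↔ (_root_.RiemannHypothesis → SpectralIsHpSpectrum) := by
  refine ⟨fun h _ => h, fun h => ?_⟩
  by_cases hRH : _root_.RiemannHypothesis
  · exact h hRH
  · exact spectralIsHpSpectrum_of_not_riemannHypothesis hRH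

/-! ## §2 The reduction handed to the prover -/

/-- Membership in a fibre: `z` must be on the critical line and `γ_i = Im z`. [folklore] -/
theorem mem_fibre_iff {ι : Type*} (γ : ι → ℝ) (z : ℂ) (i : ι) :
    i ∈ fibre γ z ↔ z.re = 1 / 2 ∧ γ i = z.im := by
  simp only [fibre, mem_setOf_eq]
  constructor
  · rintro rfl
    simp
  · rintro ⟨hre, him⟩
    apply Complex.ext <;> simp [hre, him]

/-- Off the critical line every fibre is empty. [folklore] -/
theorem fibre_eq_empty_of_re_ne {ι : Type*} (γ : ι → ℝ) {z : ℂ} (hz : z.re ≠ 1 / 2) :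
    fibre γ z = ∅ := by
  ext i
  simp only [mem_fibre_iff, mem_empty_iff_false, iff_false, not_and]
  exact fun h _ => hz h

/-- On the critical line the fibre over `1/2 + iτ` is `{i | γ_i = τ}`. [folklore] -/
theorem fibre_half_add {ι : Type*} (γ : ι → ℝ) (τ : ℝ) :
    fibre γ (1 / 2 + τ * I) = {i | γ i = τ} := by
  ext i
  simp [mem_fibre_iff]

/-- **Every fibre of a trace family is finite** (local finiteness, `finite_abs_le_of_windowTrace`
from the landed local Weyl law); so the left-hand side of the crux is never `⊤`. [folklore] -/
theorem finite_fibre {ι : Type*} {γ : ι → ℝ} (h : IsTrace γ) (z : ℂ) : (fibre γ z).Finite :=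
  (finite_abs_le_of_windowTrace one_pos (windowTrace_of_isTrace h 1) |z.im|).subset fun i hi => by
    have him := ((mem_fibre_iff γ z i).1 hi).2
    show |γ i| ≤ |z.im|
    rw [him]

/-- The analytic order of `ζ` is finite away from the pole (identity principle, `ζ(2) ≠ 0`).
[folklore] -/
theorem analyticOrderAt_riemannZeta_ne_top' {ρ : ℂ} (h : ρ ≠ 1) :
    analyticOrderAt riemannZeta ρ ≠ ⊤ := by
  intro htop
  have h2 : riemannZeta 2 = 0 :=
    analyticOn_riemannZeta.eqOn_zero_of_preconnected_of_eventuallyEq_zero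
      (isConnected_compl_singleton_of_one_lt_rank (by simp) (1 : ℂ)).isPreconnected h
      (analyticOrderAt_eq_top.mp htop) (show (2 : ℂ) ∈ ({1}ᶜ : Set ℂ) by norm_num)
  exact riemannZeta_ne_zero_of_one_le_re (s := 2) (by norm_num) h2

/-- `mult z = 0` off the non-trivial zeros. [folklore] -/
theorem mult_of_not_mem {z : ℂ} (hz : z ∉ ZetaZeros.riemannZetaNontrivialZeros) : mult z = 0 :=
  Set.indicator_of_notMem hz _

/-- At a non-trivial zero, `mult z` is the analytic order of `ζ`. [folklore] -/
theorem mult_of_mem {z : ℂ} (hz : z ∈ ZetaZeros.riemannZetaNontrivialZeros) :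
    mult z = analyticOrderAt riemannZeta z := by
  rw [mult, Set.indicator_of_mem hz, Nat.cast_analyticOrderNatAt
    (analyticOrderAt_riemannZeta_ne_top' (ZetaZeros.riemannZetaNontrivialZeros.ne_one hz))]

/-- The right-hand side of the crux is never `⊤`. [folklore] -/
theorem mult_ne_top (z : ℂ) : mult z ≠ ⊤ := by
  by_cases hz : z ∈ ZetaZeros.riemannZetaNontrivialZeros
  · rw [mult_of_mem hz]
    exact analyticOrderAt_riemannZeta_ne_top' (ZetaZeros.riemannZetaNontrivialZeros.ne_one hz)
  · rw [mult_of_not_mem hz]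
    exact ENat.coe_ne_top 0

/-- Under RH the non-trivial zeros are on the critical line (unfolding Mathlib's clauses).
[folklore] -/
theorem re_eq_half_of_mem (hRH : _root_.RiemannHypothesis) {z : ℂ}
    (hz : z ∈ ZetaZeros.riemannZetaNontrivialZeros) : z.re = 1 / 2 := by
  refine hRH z (ZetaZeros.riemannZetaNontrivialZeros.zeta_eq_zero hz) ?_
    (ZetaZeros.riemannZetaNontrivialZeros.ne_one hz)
  rintro ⟨n, hn⟩
  have h0 := ZetaZeros.riemannZetaNontrivialZeros.re_pos hz
  rw [hn] at h0
  simp at h0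
  linarith [n.cast_nonneg (α := ℝ)]

/-- **Off the critical line both sides of the crux vanish** for a trace family (the fibre is
empty; the hypothesis gives RH, which empties the right-hand side). [folklore] -/
theorem encard_fibre_eq_mult_of_re_ne_half {ι : Type*} {γ : ι → ℝ} (h : IsTrace γ) {z : ℂ}
    (hz : z.re ≠ 1 / 2) : (fibre γ z).encard = mult z := by
  rw [fibre_eq_empty_of_re_ne γ hz, Set.encard_empty,
    mult_of_not_mem fun hmem => hz (re_eq_half_of_mem (riemannHypothesis_of_isTrace h) hmem)]

/-- In the open strip, `mult s` IS the analytic order — no case split on `ζ s = 0` survives.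
[folklore] -/
theorem mult_eq_analyticOrderAt_of_mem_strip {s : ℂ} (h0 : 0 < s.re) (h1 : s.re < 1) :
    mult s = analyticOrderAt riemannZeta s := by
  by_cases hζ : riemannZeta s = 0
  · exact mult_of_mem (ZetaZeros.riemannZetaNontrivialZeros.mem_of_re_pos hζ h0)
  · rw [mult_of_not_mem fun h => hζ (ZetaZeros.riemannZetaNontrivialZeros.zeta_eq_zero h)]
    have hs : s ≠ 1 := by
      intro h; rw [h] at h1; simp at h1
    exact ((analyticOn_riemannZeta s hs).analyticOrderAt_eq_zero.2 hζ).symm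

/-- `m(s) = analyticOrderNatAt ζ s` for every `s ≠ 1`: the explicit formula's multiplicity is the
crux's multiplicity. [folklore] -/
theorem riemannZetaZeroOrder_eq_analyticOrderNatAt {s : ℂ} (hs : s ≠ 1) :
    riemannZetaZeroOrder s = (analyticOrderNatAt riemannZeta s : ℤ) := by
  have ha : AnalyticAt ℂ riemannZeta s := analyticOn_riemannZeta s hs
  obtain ⟨n, hn⟩ := ENat.ne_top_iff_exists.mp (analyticOrderAt_riemannZeta_ne_top' hs)
  rw [riemannZetaZeroOrder, ha.meromorphicOrderAt_eq, ← hn, ENat.map_coe, WithTop.untop₀_coe,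
    analyticOrderNatAt, ← hn, ENat.toNat_coe]

/-- A point `1/2 + iτ` of the critical line is not the pole. [folklore] -/
theorem half_add_ne_one (τ : ℝ) : (1 / 2 : ℂ) + τ * I ≠ 1 := by
  intro h
  have := congrArg Complex.re h
  norm_num at this

/-- **On the critical line the crux's equation is `#{i | γ_i = τ} = m(1/2+iτ)` in `ℤ`**, for any
family with finite fibres. [folklore] -/
theorem encard_fibre_eq_mult_iff {ι : Type*} (γ : ι → ℝ) (τ : ℝ) (hfin : {i | γ i = τ}.Finite) :
    (fibre γ (1 / 2 + τ * I)).encard = mult (1 / 2 + τ * I) ↔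
      (({i : ι | γ i = τ}.ncard : ℕ) : ℤ) = riemannZetaZeroOrder (1 / 2 + τ * I) := by
  have hs : (1 / 2 : ℂ) + τ * I ≠ 1 := half_add_ne_one τ
  obtain ⟨n, hn⟩ := ENat.ne_top_iff_exists.mp (analyticOrderAt_riemannZeta_ne_top' hs)
  have hnat : analyticOrderNatAt riemannZeta (1 / 2 + τ * I) = n := by
    rw [analyticOrderNatAt, ← hn, ENat.toNat_coe]
  rw [fibre_half_add, mult_eq_analyticOrderAt_of_mem_strip (by simp) (by norm_num),
    riemannZetaZeroOrder_eq_analyticOrderNatAt hs, hnat, ← hn, ← hfin.cast_ncard_eq, Nat.cast_inj,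
    Nat.cast_inj]

/-- **THE REDUCTION.** The crux is equivalent to: for every real family reproducing `W` on all
Weil tests and every real `τ`, the number of indices with `γ_i = τ` equals the multiplicity
`m(1/2 + iτ)` of the explicit formula (`riemannZetaZeroOrder`; `0` when `ζ(1/2+iτ) ≠ 0`).
All `encard`/`indicator`/`analyticOrderNatAt`/off-line bookkeeping is discharged here. [folklore] -/
theorem spectralIsHpSpectrum_iff_ordinate_count :
    SpectralIsHpSpectrum ↔ ∀ (ι : Type) (γ : ι → ℝ), IsTrace γ →
      ∀ τ : ℝ, (({i : ι | γ i = τ}.ncard : ℕ) : ℤ) = riemannZetaZeroOrder (1 / 2 + τ * I) := by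
  rw [spectralIsHpSpectrum_iff]
  constructor
  · intro h ι γ hγ τ
    have hfin : {i | γ i = τ}.Finite := by simpa only [fibre_half_add] using finite_fibre hγ (1 / 2 + τ * I)
    exact (encard_fibre_eq_mult_iff γ τ hfin).1 (h ι γ hγ _)
  · intro h ι γ hγ z
    by_cases hz : z.re = 1 / 2
    · have hzeq : z = 1 / 2 + (z.im : ℝ) * I := by
        apply Complex.ext <;> simp [hz]
      have hfin : {i | γ i = z.im}.Finite := by
        simpa only [fibre_half_add] using finite_fibre hγ (1 / 2 + (z.im : ℝ) * I)
      rw [hzeq]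
      exact (encard_fibre_eq_mult_iff γ z.im hfin).2 (h ι γ hγ z.im)
    · exact encard_fibre_eq_mult_of_re_ne_half hγ hz

/-- **THE REDUCTION, RH granted.** Since the hypothesis proves RH (§1), the prover may assume RH:
then `ρ = 1/2 + i Im ρ` for every non-trivial zero (`eq_half_add_of_riemannHypothesis`) and the
explicit formula (`hasSum_weilMellin_zeros`) is a second real trace; what remains is uniqueness of
the counting measure of a real trace (Fourier uniqueness for tempered positive measures).
[folklore] -/
theorem spectralIsHpSpectrum_iff_rigidity_under_rh :
    SpectralIsHpSpectrum ↔ ∀ (ι : Type) (γ : ι → ℝ), _root_.RiemannHypothesis → IsTrace γ →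
      ∀ τ : ℝ, (({i : ι | γ i = τ}.ncard : ℕ) : ℤ) = riemannZetaZeroOrder (1 / 2 + τ * I) := by
  rw [spectralIsHpSpectrum_iff_ordinate_count]
  exact ⟨fun h ι γ _ hγ => h ι γ hγ, fun h ι γ hγ => h ι γ (riemannHypothesis_of_isTrace hγ) hγ⟩

/-- Under RH the ordinates of the non-trivial zeros, repeated with multiplicity, form a trace
family (the calibration `SpectralConverse`, from the landed `hasSum_weilMellin_zeros`). [folklore] -/
theorem isTrace_ordinates_of_rh (hRH : _root_.RiemannHypothesis) :
    IsTrace (fun p : (Σ ρ : ZetaZeros.riemannZetaNontrivialZeros,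
      Fin (riemannZetaZeroOrder (ρ : ℂ)).toNat) => (p.1 : ℂ).im) :=
  fun _ hg => by simpa only [eq_half_add_of_riemannHypothesis hRH] using hasSum_weilMellin_zeros hg

/-! ## §3 Load-bearing hypotheses -/

/-- The crux with `HasSum … (W g)` weakened to mere summability (the VALUE of the trace dropped).
[folklore] -/
def SpectralIsHpSpectrumWithoutValue : Prop :=
  ∀ (ι : Type) (γ : ι → ℝ),
    (∀ g : ℝ → ℂ, IsWeilTest g → Summable fun i => weilMellin g (1 / 2 + (γ i : ℂ) * I)) →
      ∀ z : ℂ, (fibre γ z).encard = mult z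

/-- **`ζ` has a non-trivial zero**, from the Weil machinery alone: otherwise the complex zero
spectrum (`hasSum_weilMellin_zeros`) is empty, `W ≡ 0` on Weil tests, and the EMPTY real family
would be a window trace — excluded by `not_windowTrace_finite`. [folklore] -/
theorem nontrivialZeros_nonempty : ZetaZeros.riemannZetaNontrivialZeros.Nonempty := by
  by_contra h
  have hE : IsEmpty (Σ ρ : ZetaZeros.riemannZetaNontrivialZeros,
      Fin (riemannZetaZeroOrder (ρ : ℂ)).toNat) :=
    ⟨fun p => h ⟨(p.1 : ℂ), p.1.2⟩⟩
  have hW : ∀ g : ℝ → ℂ, IsWeilTest g → weilFunctional g = 0 := fun g hg =>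
    (hasSum_weilMellin_zeros hg).unique hasSum_empty
  refine not_windowTrace_finite one_pos ⟨PEmpty, inferInstance, fun i => i.elim, fun g hg _ => ?_⟩
  rw [hW g hg]
  exact hasSum_empty

/-- **FALSE WITHOUT THE VALUE.** Witness: the empty family (vacuously summable) against any
non-trivial zero. Any proof of the crux must use the explicit formula, not just convergence.
[folklore] -/
theorem spectralIsHpSpectrum_false_without_value : ¬ SpectralIsHpSpectrumWithoutValue := by
  intro h
  obtain ⟨ρ, hρ⟩ := nontrivialZeros_nonempty
  have h1 := h PEmpty (fun i => i.elim) (fun g _ => (hasSum_empty (f := fun i : PEmpty =>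
    weilMellin g (1 / 2 + ((PEmpty.elim i : ℝ) : ℂ) * I))).summable) ρ
  have h0 : (fibre (fun i : PEmpty => (i.elim : ℝ)) ρ).encard = 0 := by
    rw [Set.encard_eq_zero]
    exact Set.eq_empty_of_isEmpty _
  rw [h0, mult_of_mem hρ, eq_comm, analyticOrderAt_eq_zero] at h1
  rcases h1 with hna | hne
  · exact hna (analyticOn_riemannZeta ρ (ZetaZeros.riemannZetaNontrivialZeros.ne_one hρ))
  · exact hne (ZetaZeros.riemannZetaNontrivialZeros.zeta_eq_zero hρ)

/-- The crux with the tests restricted to a window `tsupport g ⊆ [-A, A]` (a STRONGER statement: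
rigidity of window traces). [folklore] -/
def SpectralIsHpSpectrumOnWindow (A : ℝ) : Prop :=
  ∀ (ι : Type) (γ : ι → ℝ),
    (∀ g : ℝ → ℂ, IsWeilTest g → tsupport g ⊆ Icc (-A) A →
      HasSum (fun i => weilMellin g (1 / 2 + (γ i : ℂ) * I)) (weilFunctional g)) →
    ∀ z : ℂ, (fibre γ z).encard = mult z

/-- Every window version implies the crux. [folklore] -/
theorem onWindow_imp (A : ℝ) : SpectralIsHpSpectrumOnWindow A → SpectralIsHpSpectrum :=
  fun h ι γ hγ => h ι γ (windowTrace_of_isTrace hγ A)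

/-- **Window rigidity is FALSE for `A ≤ 0`** (tightness of "all tests", degenerate end): the
window carries only `g = 0`, so the junk family `ℕ ↦ 0` is a witness, with fibre `univ` over
`z = 1/2` (`encard = ⊤`) against a finite right-hand side. No number theory enters. [folklore] -/
theorem spectralIsHpSpectrum_false_on_window_of_nonpos {A : ℝ} (hA : A ≤ 0) :
    ¬ SpectralIsHpSpectrumOnWindow A := by
  intro h
  have hγ : ∀ g : ℝ → ℂ, IsWeilTest g → tsupport g ⊆ Icc (-A) A →
      HasSum (fun _ : ℕ => weilMellin g (1 / 2 + ((0 : ℝ) : ℂ) * I)) (weilFunctional g) := by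
    intro g hg hgs
    have hsupp := support_subset_Ioo_of_tsupport_subset_Icc hg.1.continuous hgs
    rw [Set.Ioo_eq_empty (by linarith : ¬ (-A < A)), Set.subset_empty_iff,
      Function.support_eq_empty_iff] at hsupp
    rw [hsupp, weilFunctional_zero]
    simp only [weilMellin, Pi.zero_apply, zero_mul, integral_zero]
    exact hasSum_zero
  have h1 := h ℕ (fun _ => 0) hγ (1 / 2)
  have hfib : fibre (fun _ : ℕ => (0 : ℝ)) (1 / 2) = Set.univ := by
    ext n
    simp [fibre]
  rw [hfib, Set.infinite_univ.encard_eq] at h1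
  exact mult_ne_top _ h1.symm

/-! ## §4 Natural variants decided -/

/-- The variant of the crux with ALL zeros of `ζ` (trivial ones included) on the right. [folklore] -/
def SpectralIsHpSpectrumAllZeros : Prop :=
  ∀ (ι : Type) (γ : ι → ℝ), IsTrace γ → ∀ z : ℂ,
    (fibre γ z).encard = riemannZetaZeros.indicator (fun w => (analyticOrderNatAt riemannZeta w : ℕ∞)) z

/-- **The all-zeros variant is equivalent to `¬ RH`.** (→) under RH the ordinate family is a trace,
its fibre over the trivial zero `-2` is empty while the multiplicity there is `≥ 1`;
(←) without RH no trace family exists (§1). [folklore] -/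
theorem spectralIsHpSpectrumAllZeros_iff_not_rh :
    SpectralIsHpSpectrumAllZeros ↔ ¬ _root_.RiemannHypothesis := by
  constructor
  · intro h hRH
    have h1 := h _ _ (isTrace_ordinates_of_rh hRH) (-2)
    have hne1 : (-2 : ℂ) ≠ 1 := by norm_num
    have hζ : riemannZeta (-2) = 0 := by
      simpa using riemannZeta_neg_two_mul_nat_add_one 0
    have hmem : (-2 : ℂ) ∈ riemannZetaZeros := by
      simpa [riemannZetaZeros] using hζ
    rw [fibre_eq_empty_of_re_ne _ (by norm_num), Set.encard_empty, Set.indicator_of_mem hmem,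
      Nat.cast_analyticOrderNatAt (analyticOrderAt_riemannZeta_ne_top' hne1), eq_comm,
      analyticOrderAt_eq_zero] at h1
    rcases h1 with hna | hne
    · exact hna (analyticOn_riemannZeta _ hne1)
    · exact hne hζ
  · intro hRH ι γ hγ
    exact absurd (riemannHypothesis_of_isTrace hγ) hRH

/-! ## §5 Near-misses and open variants (docstrings only)

* WINDOW RIGIDITY, `A > 0` (`SpectralIsHpSpectrumOnWindow A`): expected FALSE — exponentials
  `{e^{iγt}}` are overcomplete on a finite window, and already the toy functional `2L·δ₀`
  (`L > A`) has two unit-multiplicity real realisations with different multiplicity functions on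
  tests supported in `(-L, L)`: the simple lattice `(π/L)ℤ` and the DOUBLED lattice `2 × (2π/L)ℤ`
  (Poisson summation: `Σ_n ĝ(πn/L) = 2L Σ_k g(2kL)`, `Σ_n ĝ(2πn/L) = L Σ_k g(kL)`). A witness
  against `SpectralIsHpSpectrumOnWindow A` itself needs a window trace for `W` that is not the
  zeta multiset — at least as hard as the route's construction cruxes (`WindowTraceArch`), so it is
  not attempted here. NOT load-bearing for the crux (which quantifies over all tests).
* COMPLEX SPECTRA: `exists_complex_spectrum` makes the hypothesis a theorem once `γ_i ∈ ℂ` is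
  allowed; whether complex configurations reproducing `W` are unique is NOT asserted either way.
* WEIGHTS: positive real weights `c_i` instead of unit masses — rigidity still holds (same
  measure-uniqueness proof); complex weights — still holds given `HasSum` for all tests
  (unconditional convergence in `ℂ` forces local finiteness of `Σ |c_i| δ_{γ_i}` via a positive
  test with `Re ĝ > 0` on a compact). So unit masses are decoration for THIS item.
-/

end Summit.RiemannHypothesis.RiemannHypothesis.Cruxes.SpectralIsHpSpectrum.Disproof

end
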